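import Summits.Parity.GeneralizedHardyLittlewood.Theorems.GreenTaoLevelTwoGITwoCyclicInverseLocalBogolyubov
import Summits.Parity.GeneralizedHardyLittlewood.Theorems.GreenTaoLevelTwoGITwoCyclicInverseGenFourierDecay

/-!
# Route `GreenTaoLevelTwo`, crux `GITwo` (stmt-Parity-21275), line `birth`, stub `stub_cyclicInverse`:
# the endgame of the symmetry argument (GT08a arXiv Lemma 46, displays (eq9.79) ⇒ (sym))

Forty-second helper file toward the XL stub `stub_cyclicInverse` (B. Green, T. Tao, *An inverse
theorem for the Gowers `U³(G)` norm*, arXiv:math/0503014, Thm. 68 = PEMS 51 (2008) Thm. 12.8).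
Block C12: the LAST THIRD of the proof of arXiv Lemma 46, composed from landed bricks.  Once the
averaging part of the symmetry argument has produced a point `y'` and a dense set `A ⊆ B₂ = B(S,ρ₂)`
(regular) with `|Σ_{x∈B₂} e({x, y'−y})| ≥ c₂ #B₂` for all `y ∈ A` (display before (eq9.79)), where
`{x,y} = μ(x)·y − μ(y)·x` is the antisymmetric form of the locally additive frequency map `μ`
(`= 2M`), one gets: generalized Fourier decay (arXiv Lemma 38, `norm_phase_le_of_locAdd`) ⇒
`‖{x, y'−y}‖ ≤ 2¹²d‖x‖_S/(ρ₂c₂²)`; local bilinearity (`antisym_add_left/right`) ⇒ the same with a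
factor `4` for every `z ∈ 2A − 2A` written as `(a−c)+(a'−c')` (cf. `…LocalBilinear`); the local
Bogolyubov lemma
(arXiv Lemma 42, `local_bogolyubov`) ⇒ a Bohr set `B(S ∪ F, r) ⊆ 2A − 2A`.  Hence display (sym):
`‖{x,z}‖ ≤ 2¹⁴ d t/(ρ₂ c₂²)` for all `x` with `‖x‖_S ≤ t` and all `z` in that Bohr set.  (In the
`μ = 2M` normalisation no halving of the frequency set is needed.)

* `norm_toAddCircle_sub_mul_le` — `‖(p−q)ξ‖ ≤ ‖pξ‖ + ‖qξ‖`;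
* `symmetry_endgame` — the statement above.

References: [GreenTao2008U3Inverse] arXiv:math/0503014, Lemma 46 (end of proof).
-/

noncomputable section

namespace Summit.Parity.GeneralizedHardyLittlewood.GreenTaoLevelTwoGITwoCyclicInverse

open Finset

variable {N : ℕ} [NeZero N]

/-- `‖(p−q)ξ‖_{ℝ/ℤ} ≤ ‖pξ‖ + ‖qξ‖`. [folklore] -/
theorem norm_toAddCircle_sub_mul_le (p q ξ : ZMod N) :
    ‖ZMod.toAddCircle ((p - q) * ξ)‖ ≤ ‖ZMod.toAddCircle (p * ξ)‖ + ‖ZMod.toAddCircle (q * ξ)‖ := by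
  rw [sub_mul, map_sub]; exact norm_sub_le _ _

/-- `‖(p+q)ξ‖_{ℝ/ℤ} ≤ ‖pξ‖ + ‖qξ‖`. [folklore] -/
theorem norm_toAddCircle_add_mul_le (p q ξ : ZMod N) :
    ‖ZMod.toAddCircle ((p + q) * ξ)‖ ≤ ‖ZMod.toAddCircle (p * ξ)‖ + ‖ZMod.toAddCircle (q * ξ)‖ := by
  rw [add_mul, map_add]; exact norm_add_le _ _

/-- **Endgame of the symmetry argument (GT08a arXiv Lemma 46).**  Let `S` be nonempty (`d = #S`),
`0 < ρ₂ ≤ 1/64`, `B₂ = B(S,ρ₂)` regular, `μ : ℤ/Nℤ → ℤ/Nℤ` additive on `B(S,¼)` (closed form), and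
write `{x,y} = toAddCircle(μ(x)y) − toAddCircle(μ(y)x)`.  Suppose `y' ∈ B₂`, `A ⊆ B₂`,
`#A ≥ c₁ #B₂` and `|Σ_{x∈B₂} e({x, y'−y})| ≥ c₂ #B₂` for every `y ∈ A` (`0 < c₁, c₂ ≤ 1`).  Then there
are `ρ' ≥ c₁ρ₂/(800d)` and `F` with `#F ≤ 128/c₁⁴` such that for all `t > 0`, all `x` with
`‖xξ‖ ≤ t` (`ξ ∈ S`) and all `z` with `‖zξ‖ < c₁⁸ρ'/(2³²d)` (`ξ ∈ S`), `‖zζ‖ ≤ 1/12` (`ζ ∈ F`):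
`‖{x,z}‖ ≤ 4 · 2¹² d t/(ρ₂ c₂²)`. [cite: GreenTao2008U3Inverse, Lemma 46] -/
theorem symmetry_endgame (S : Finset (ZMod N)) (hS : S.Nonempty) {ρ₂ c₁ c₂ : ℝ} (hρ : 0 < ρ₂)
    (hρ32 : ρ₂ ≤ 1 / 64) (hc₁ : 0 < c₁) (hc₁1 : c₁ ≤ 1) (hc₂ : 0 < c₂) (hc₂1 : c₂ ≤ 1)
    (hreg : ∀ κ : ℝ, |κ| ≤ 1 / (100 * (#S : ℝ)) →
      (1 - 100 * (#S : ℝ) * |κ|) * #{x : ZMod N | ∀ ξ ∈ S, ‖ZMod.toAddCircle (x * ξ)‖ < ρ₂} ≤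
          #{x : ZMod N | ∀ ξ ∈ S, ‖ZMod.toAddCircle (x * ξ)‖ < (1 + κ) * ρ₂} ∧
        (#{x : ZMod N | ∀ ξ ∈ S, ‖ZMod.toAddCircle (x * ξ)‖ < (1 + κ) * ρ₂} : ℝ) ≤
          (1 + 100 * (#S : ℝ) * |κ|) * #{x : ZMod N | ∀ ξ ∈ S, ‖ZMod.toAddCircle (x * ξ)‖ < ρ₂})
    {μ : ZMod N → ZMod N}
    (hadd : ∀ h₁ h₂ : ZMod N, (∀ ξ' ∈ S, ‖ZMod.toAddCircle (h₁ * ξ')‖ ≤ 1 / 4) →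
      (∀ ξ' ∈ S, ‖ZMod.toAddCircle (h₂ * ξ')‖ ≤ 1 / 4) →
      (∀ ξ' ∈ S, ‖ZMod.toAddCircle ((h₁ + h₂) * ξ')‖ ≤ 1 / 4) → μ (h₁ + h₂) = μ h₁ + μ h₂)
    {y' : ZMod N} (hy' : ∀ ξ ∈ S, ‖ZMod.toAddCircle (y' * ξ)‖ < ρ₂)
    {A : Finset (ZMod N)}
    (hA : A ⊆ ({x : ZMod N | ∀ ξ ∈ S, ‖ZMod.toAddCircle (x * ξ)‖ < ρ₂} : Finset (ZMod N)))
    (hAcard : c₁ * #{x : ZMod N | ∀ ξ ∈ S, ‖ZMod.toAddCircle (x * ξ)‖ < ρ₂} ≤ #A)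
    (hbias : ∀ y ∈ A, c₂ * #{x : ZMod N | ∀ ξ ∈ S, ‖ZMod.toAddCircle (x * ξ)‖ < ρ₂} ≤
      ‖∑ x ∈ ({x : ZMod N | ∀ ξ ∈ S, ‖ZMod.toAddCircle (x * ξ)‖ < ρ₂} : Finset (ZMod N)),
        ((AddCircle.toCircle
          (ZMod.toAddCircle (μ x * (y' - y)) - ZMod.toAddCircle (μ (y' - y) * x)) : Circle) : ℂ)‖) :
    ∃ (ρ' : ℝ) (F : Finset (ZMod N)), c₁ / (800 * (#S : ℝ)) * ρ₂ ≤ ρ' ∧ (#F : ℝ) ≤ 128 / c₁ ^ 4 ∧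
      ∀ (t : ℝ), 0 < t → ∀ x : ZMod N, (∀ ξ ∈ S, ‖ZMod.toAddCircle (x * ξ)‖ ≤ t) →
        ∀ z : ZMod N, (∀ ξ ∈ S, ‖ZMod.toAddCircle (z * ξ)‖ < c₁ ^ 8 / (2 ^ 32 * (#S : ℝ)) * ρ') →
          (∀ ζ ∈ F, ‖ZMod.toAddCircle (z * ζ)‖ ≤ 1 / 12) →
            ‖ZMod.toAddCircle (μ x * z) - ZMod.toAddCircle (μ z * x)‖ ≤
              4 * (2 ^ 12 * (#S : ℝ) * t / (ρ₂ * c₂ ^ 2)) := by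
  classical
  set B₂ : Finset (ZMod N) := {x : ZMod N | ∀ ξ ∈ S, ‖ZMod.toAddCircle (x * ξ)‖ < ρ₂} with hB₂
  have hB₂mem : ∀ x, x ∈ B₂ → ∀ ξ ∈ S, ‖ZMod.toAddCircle (x * ξ)‖ < ρ₂ := fun x hx => by
    rw [hB₂, mem_filter] at hx; exact hx.2
  -- local Bogolyubov
  obtain ⟨ρ', F, hρ', hF, hrepr⟩ := local_bogolyubov S hS hρ hc₁ hc₁1 hreg hA hAcard
  refine ⟨ρ', F, hρ', hF, fun t ht0 x hxt z hzS hzF => ?_⟩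
  obtain ⟨a, ha, c, hc, a', ha', c', hc', hz⟩ := hrepr z hzS hzF
  -- bounds on `y' − w`, `w ∈ A`
  have hu : ∀ w ∈ A, ∀ ξ ∈ S, ‖ZMod.toAddCircle ((y' - w) * ξ)‖ ≤ 2 * ρ₂ := by
    intro w hw ξ hξ
    have := norm_toAddCircle_sub_mul_le y' w ξ
    linarith [hy' ξ hξ, hB₂mem w (hA hw) ξ hξ]
  -- additivity of `μ` on small elements (all radii `≤ 8ρ₂ ≤ 1/4`)
  have hadd' : ∀ p q : ZMod N, ∀ sp sq : ℝ, (∀ ξ ∈ S, ‖ZMod.toAddCircle (p * ξ)‖ ≤ sp) →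
      (∀ ξ ∈ S, ‖ZMod.toAddCircle (q * ξ)‖ ≤ sq) → sp + sq ≤ 1 / 4 → 0 ≤ sp → 0 ≤ sq →
      μ (p + q) = μ p + μ q := by
    intro p q sp sq hp hq hs hsp hsq
    refine hadd p q (fun ξ hξ => (hp ξ hξ).trans (by linarith))
      (fun ξ hξ => (hq ξ hξ).trans (by linarith)) (fun ξ hξ => ?_)
    exact (norm_toAddCircle_add_mul_le p q ξ).trans (by linarith [hp ξ hξ, hq ξ hξ])
  -- arXiv Lemma 38 for `φ_w(x) = {x, y' − w}`, `w ∈ A`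
  have hK : ∀ w ∈ A, ‖ZMod.toAddCircle (μ x * (y' - w)) - ZMod.toAddCircle (μ (y' - w) * x)‖ ≤
      2 ^ 12 * (#S : ℝ) * t / (ρ₂ * c₂ ^ 2) := by
    intro w hw
    have hloc : ∀ x₁ ∈ B₂, ∀ x₂ ∈ B₂,
        (fun v => ZMod.toAddCircle (μ v * (y' - w)) - ZMod.toAddCircle (μ (y' - w) * v)) (x₁ + x₂) =
        (fun v => ZMod.toAddCircle (μ v * (y' - w)) - ZMod.toAddCircle (μ (y' - w) * v)) x₁ +
        (fun v => ZMod.toAddCircle (μ v * (y' - w)) - ZMod.toAddCircle (μ (y' - w) * v)) x₂ := by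
      intro x₁ hx₁ x₂ hx₂
      have hM : μ (x₁ + x₂) = μ x₁ + μ x₂ :=
        hadd' x₁ x₂ ρ₂ ρ₂ (fun ξ hξ => (hB₂mem x₁ hx₁ ξ hξ).le)
          (fun ξ hξ => (hB₂mem x₂ hx₂ ξ hξ).le) (by linarith) hρ.le hρ.le
      simp only
      rw [hM, add_mul, mul_add, map_add, map_add]
      abel
    exact norm_phase_le_of_locAdd S hS hρ hc₂ hc₂1 hreg
      (φ := fun v => ZMod.toAddCircle (μ v * (y' - w)) - ZMod.toAddCircle (μ (y' - w) * v))
      hloc (hbias w hw) ht0 hxt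
  -- second-slot additivity along `z = (y'−c) + (y'−c') − (y'−a) − (y'−a')`
  set uc := y' - c with huc
  set uc' := y' - c' with huc'
  set ua := y' - a with hua
  set ua' := y' - a' with hua'
  have hz' : z = ((uc + uc') - ua) - ua' := by rw [← hz, huc, huc', hua, hua']; ring
  -- `{x, V}` for `V = uc + uc'`
  have hV : μ (uc + uc') = μ uc + μ uc' :=
    hadd' uc uc' (2 * ρ₂) (2 * ρ₂) (hu c hc) (hu c' hc') (by linarith) (by linarith) (by linarith)
  have hVb : ∀ ξ ∈ S, ‖ZMod.toAddCircle ((uc + uc') * ξ)‖ ≤ 4 * ρ₂ := fun ξ hξ =>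
    (norm_toAddCircle_add_mul_le uc uc' ξ).trans (by linarith [hu c hc ξ hξ, hu c' hc' ξ hξ])
  -- `W = V − ua`: `μ V = μ W + μ ua`
  have hWb : ∀ ξ ∈ S, ‖ZMod.toAddCircle ((uc + uc' - ua) * ξ)‖ ≤ 6 * ρ₂ := fun ξ hξ =>
    (norm_toAddCircle_sub_mul_le _ ua ξ).trans (by linarith [hVb ξ hξ, hu a ha ξ hξ])
  have hW : μ (uc + uc') = μ (uc + uc' - ua) + μ ua := by
    have := hadd' (uc + uc' - ua) ua (6 * ρ₂) (2 * ρ₂) hWb (hu a ha) (by linarith) (by linarith)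
      (by linarith)
    rwa [sub_add_cancel] at this
  -- `z = W − ua'`: `μ W = μ z + μ ua'`
  have hZb : ∀ ξ ∈ S, ‖ZMod.toAddCircle ((uc + uc' - ua - ua') * ξ)‖ ≤ 8 * ρ₂ := fun ξ hξ =>
    (norm_toAddCircle_sub_mul_le _ ua' ξ).trans (by linarith [hWb ξ hξ, hu a' ha' ξ hξ])
  have hZ : μ (uc + uc' - ua) = μ (uc + uc' - ua - ua') + μ ua' := by
    have := hadd' (uc + uc' - ua - ua') ua' (8 * ρ₂) (2 * ρ₂) hZb (hu a' ha') (by linarith)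
      (by linarith) (by linarith)
    rwa [sub_add_cancel] at this
  -- the form at `z` as a signed sum of four forms
  have hform : ZMod.toAddCircle (μ x * z) - ZMod.toAddCircle (μ z * x) =
      (ZMod.toAddCircle (μ x * uc) - ZMod.toAddCircle (μ uc * x)) +
      (ZMod.toAddCircle (μ x * uc') - ZMod.toAddCircle (μ uc' * x)) -
      (ZMod.toAddCircle (μ x * ua) - ZMod.toAddCircle (μ ua * x)) -
      (ZMod.toAddCircle (μ x * ua') - ZMod.toAddCircle (μ ua' * x)) := by
    have hμz : μ z = μ uc + μ uc' - μ ua - μ ua' := by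
      rw [hz']
      linear_combination hV - hW - hZ
    rw [hμz, hz']
    simp only [sub_mul, add_mul, mul_sub, mul_add, map_add, map_sub]
    abel
  rw [hform]
  have h1 := hK c hc
  have h2 := hK c' hc'
  have h3 := hK a ha
  have h4 := hK a' ha'
  calc ‖(ZMod.toAddCircle (μ x * uc) - ZMod.toAddCircle (μ uc * x)) +
        (ZMod.toAddCircle (μ x * uc') - ZMod.toAddCircle (μ uc' * x)) -
        (ZMod.toAddCircle (μ x * ua) - ZMod.toAddCircle (μ ua * x)) -
        (ZMod.toAddCircle (μ x * ua') - ZMod.toAddCircle (μ ua' * x))‖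
      ≤ ‖ZMod.toAddCircle (μ x * uc) - ZMod.toAddCircle (μ uc * x)‖ +
        ‖ZMod.toAddCircle (μ x * uc') - ZMod.toAddCircle (μ uc' * x)‖ +
        ‖ZMod.toAddCircle (μ x * ua) - ZMod.toAddCircle (μ ua * x)‖ +
        ‖ZMod.toAddCircle (μ x * ua') - ZMod.toAddCircle (μ ua' * x)‖ := by
          refine (norm_sub_le _ _).trans (add_le_add ((norm_sub_le _ _).trans
            (add_le_add (norm_add_le _ _) le_rfl)) le_rfl)
    _ ≤ 4 * (2 ^ 12 * (#S : ℝ) * t / (ρ₂ * c₂ ^ 2)) := by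
          rw [huc, huc', hua, hua'] at *
          linarith

end Summit.Parity.GeneralizedHardyLittlewood.GreenTaoLevelTwoGITwoCyclicInverse
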